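import Mathlib
import Summits.KontsevichZagierPeriods.Zeta5Search.CVBlockReduction
import Summits.KontsevichZagierPeriods.Zeta5Search.MixedPairTermwiseProof
import HarnessLib

/-!
# ζ(5) search — (CV) in the window from `MultiBlockLaw` + the combinatorial `MixedPairBoundLevel`

Cell `pub-zeta5` (HONEST FRAMING: systematic search; no irrationality claim unless certified), typer seat
generation 9.  With `mixedPairTermwise_holds` (typer g9) the mixed-pair law is the observed bound-level inequality alone:

* `mixedPairLaw_of_boundLevel : MixedPairBoundLevel → MixedPairLaw`;
* `casoratianValuationLaw_of_multiBlock_boundLevel : MultiBlockLaw → MixedPairBoundLevel → CasoratianValuationLaw`.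

CONDITIONAL results by design (the two hypotheses are OBSERVED statements of gen-2 g8/g9); `p`-adic bookkeeping only; nothing about irrationality.
-/

noncomputable section

namespace Summit.KontsevichZagierPeriods.Zeta5Search.ClusterValuation

open Summit.KontsevichZagierPeriods.Zeta5Search.CasoratianValuation (CasoratianValuationLaw)

/-- **`MixedPairLaw` ⇐ `MixedPairBoundLevel`** (with the proved termwise bound). -/
theorem mixedPairLaw_of_boundLevel (hL : MixedPairBoundLevel) : MixedPairLaw := by
  intro b j p x y hb hj1 hj7 hb' hprime hp5 hpb hwin hx hy hmulti hone hne
  have h1 := hL b p x y hb hprime hp5 hpb hwin hx hy hmulti hone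
  have h2 := mixedPairTermwise_holds b j p x y hb hj1 hj7 hb' hprime hp5 hpb hwin hx hy hmulti hone hne
  exact h1.trans h2

/-- **(CV) ⇐ `MultiBlockLaw` + `MixedPairBoundLevel`.** -/
theorem casoratianValuationLaw_of_multiBlock_boundLevel (hM : MultiBlockLaw) (hL : MixedPairBoundLevel) :
    CasoratianValuationLaw :=
  casoratianValuationLaw_of_blockLaws hM (mixedPairLaw_of_boundLevel hL)

end Summit.KontsevichZagierPeriods.Zeta5Search.ClusterValuation

end
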